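import Mathlib
import HarnessLib
import Summits.RiemannHypothesis.RiemannHypothesis.Theorems.IntegerScrewParityDefect
import Summits.RiemannHypothesis.RiemannHypothesis.Theorems.IntegerScrewVonMangoldtCoupling
import Summits.RiemannHypothesis.RiemannHypothesis.Theorems.IntegerScrewWalkDirichlet

/-!
# Route `IntegerScrew` — the centred 2-parity test function for the SPECTRAL GAP of the truncated multiplicative
# walk: Rayleigh quotient `≤ 2 log 2/L − (1/L)(log 2/4 − log 2/(2H_M))/‖g‖²` (PIVOT-LAW 13.10 (iv); CONTINUUM-LIMIT
# 23.18 (f): the atom `{2}` sits at `Λ_{2} = 2 log 2 − δ_{2}/L`, `δ_{2} > 0`; the gap theorems are in `IntegerScrewWalkGap`)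

`walkGen M` is reversible for `π(k) ∝ 1/k` (`walkRate_detailed_balance`), so `−walkGen M` is self-adjoint `≥ 0`
on `ℓ²(π)` with simple eigenvalue `0`; its gap is `min {E(g)/‖g‖²_π : g ⊥_π 1}`, `E(g) = −⟨g, walkGen·g⟩_π`, equal to
`2 log 2/L` in the limit (PIVOT-LAW 13.10 (iv), atom `S = {2}`).  From `IntegerScrewParityDefect.walkGen_parity`
(`ℒφ₂ = −(2log 2/L)φ₂ + r₂/L`, `r₂ ≥ (log 2)·k/M` on odd `k`) and `0 ≤ Σ_{odd ≤ M}1/k − Σ_{even ≤ M}1/k ≤ 1`: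

* `parityDefect_ge` — `log p/((p−1)y) ≤ log p/(p−1) − Σ_{n ≤ y, p ∣ n}Λ(n)/n` (`y ≥ 1`);
* `sum_inv_multiples_eq` — `Σ_{j≤M, q|j}1/j = H_{⌊M/q⌋}/q` (the truncated harmonic measure's divisibility odds, 23.18 (h));
* `sum_parityFun_two_div` — `Σ_{k ≤ M} φ₂(k)/k = ½ Σ_{M/2 < k ≤ M} 1/k ∈ [0, ½]`;
* `parityX_ge_quarter` — the blocked-birth term `X(M) = Σ_{odd k ≤ M} r₂(⌊M/k⌋)/(2k) ≥ log 2/4`;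
* **`parity_test_function_of_le`**, `parity_test_function` — for `M ≥ 2` and `B ≤ X(M)` (e.g. `B = log 2/4`) there is
  `g : {1..M} → ℝ` with `Σ g(k)/k = 0`, `g ≢ 0`, `Σ g²/k ≤ H_M/4`, and
  `−Σ_k (g(k)/k)·Σ_j walkGen(k,j)g(j) ≤ (2 log 2/log M)·Σ_k g(k)²/k − (1/log M)(B − log 2/(2H_M))`.

RH-free; nothing here bears on the truth of RH.  References: PIVOT-LAW §13.10 (iv), CONTINUUM-LIMIT §23.18;
M. Suzuki, J. Lond. Math. Soc. (2) 108 (2023) 1448–1487 [Suzuki2023].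
-/

noncomputable section

set_option linter.dupNamespace false -- D-0017: `Summit.<S>.<S>.…` is the designed namespace

namespace Summit.RiemannHypothesis.RiemannHypothesis.Theorems.IntegerScrew

open Finset ArithmeticFunction

/-! ### A sharper lower bound for the blocked-birth defect -/
/-- `Σ_{n ≤ y, p ∣ n} Λ(n)/n ≤ (log p/(p−1))·(1 − p^{−⌊log_p y⌋})`: only `p, p², …, p^{⌊log_p y⌋}` contribute. -/
theorem sum_Icc_dvd_vonMangoldt_div_le_sharp {p : ℕ} (hp : p.Prime) (y : ℕ) :
    ∑ n ∈ (Icc 1 y).filter (fun n => p ∣ n), Λ n / n ≤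
      Real.log p / ((p : ℝ) - 1) * (1 - ((p : ℝ) ^ Nat.log p y)⁻¹) := by
  have hp1 : (1 : ℝ) < p := by exact_mod_cast hp.one_lt
  have hp0 : (0 : ℝ) < p := by linarith
  set A := Nat.log p y with hA
  set T : Finset ℕ := (Finset.range A).image (fun a => p ^ (a + 1)) with hT
  have hsub : ∀ n ∈ (Icc 1 y).filter (fun n => p ∣ n), Λ n / n ≠ 0 → n ∈ T := by
    intro n hn hne
    rw [Finset.mem_filter, Finset.mem_Icc] at hn
    have hΛ : Λ n ≠ 0 := by intro h; apply hne; rw [h, zero_div]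
    obtain ⟨q, b, hq, hb, rfl⟩ := vonMangoldt_ne_zero_iff.1 hΛ
    have hqp : q.Prime := hq.nat_prime
    have hqeq : q = p := ((Nat.prime_dvd_prime_iff_eq hp hqp).1 (hp.dvd_of_dvd_pow hn.2)).symm
    subst hqeq
    rw [hT, Finset.mem_image]
    refine ⟨b - 1, ?_, by congr 1; omega⟩
    rw [Finset.mem_range]
    -- b ≤ log_q y since q^b ≤ y
    have hble : b ≤ Nat.log q y := Nat.le_log_of_pow_le hqp.one_lt hn.1.2
    omega
  have h1 : ∑ n ∈ (Icc 1 y).filter (fun n => p ∣ n), Λ n / n ≤ ∑ n ∈ T, Λ n / n := by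
    rw [← Finset.sum_filter_ne_zero ((Icc 1 y).filter (fun n => p ∣ n))]
    refine Finset.sum_le_sum_of_subset_of_nonneg ?_ fun n _ _ => div_nonneg vonMangoldt_nonneg (Nat.cast_nonneg n)
    intro n hn
    rw [Finset.mem_filter] at hn
    exact hsub n hn.1 hn.2
  refine h1.trans (le_of_eq ?_)
  have hinj : Set.InjOn (fun a => p ^ (a + 1)) (Finset.range A : Set ℕ) := by
    intro a _ b _ h
    have := Nat.pow_right_injective hp.two_le h
    omega
  rw [hT, Finset.sum_image hinj]
  have hterm : ∀ a ∈ Finset.range A,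
      Λ (p ^ (a + 1)) / ((p ^ (a + 1) : ℕ) : ℝ) = Real.log p * ((p : ℝ)⁻¹ * (p : ℝ)⁻¹ ^ a) := by
    intro a _
    rw [vonMangoldt_apply_pow (Nat.succ_ne_zero a), vonMangoldt_apply_prime hp, Nat.cast_pow, ← pow_succ',
      inv_pow, div_eq_mul_inv]
  rw [Finset.sum_congr rfl hterm, ← Finset.mul_sum, ← Finset.mul_sum,
    geom_sum_eq (inv_ne_one.2 hp1.ne')]
  have hp1' : (p : ℝ) - 1 ≠ 0 := by linarith
  have h1p : (1 : ℝ) - p ≠ 0 := by linarith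
  have e1 : (p : ℝ)⁻¹ - 1 = (1 - p) / p := by field_simp
  rw [e1, inv_pow]
  field_simp
  ring

/-- **Defect lower bound**: `log p/((p−1)·y) ≤ log p/(p−1) − Σ_{n ≤ y, p ∣ n} Λ(n)/n` for `y ≥ 1`
(since `p^{⌊log_p y⌋} ≤ y`). -/
theorem parityDefect_ge {p : ℕ} (hp : p.Prime) {y : ℕ} (hy : 1 ≤ y) :
    Real.log p / ((p : ℝ) - 1) / y ≤
      Real.log p / ((p : ℝ) - 1) - ∑ n ∈ (Icc 1 y).filter (fun n => p ∣ n), Λ n / n := by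
  have hp1 : (1 : ℝ) < p := by exact_mod_cast hp.one_lt
  have h := sum_Icc_dvd_vonMangoldt_div_le_sharp hp y
  have hpow : ((p : ℝ) ^ Nat.log p y) ≤ y := by exact_mod_cast Nat.pow_log_le_self p (by omega : y ≠ 0)
  have hpow0 : (0 : ℝ) < (p : ℝ) ^ Nat.log p y := by positivity
  have hy0 : (0 : ℝ) < y := by exact_mod_cast hy
  have hc : 0 ≤ Real.log p / ((p : ℝ) - 1) := div_nonneg (Real.log_nonneg hp1.le) (by linarith)
  have hinv : (1 : ℝ) / y ≤ ((p : ℝ) ^ Nat.log p y)⁻¹ := by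
    rw [one_div]; exact inv_anti₀ hpow0 hpow
  calc Real.log p / ((p : ℝ) - 1) / y = Real.log p / ((p : ℝ) - 1) * (1 / y) := by ring
    _ ≤ Real.log p / ((p : ℝ) - 1) * ((p : ℝ) ^ Nat.log p y)⁻¹ := mul_le_mul_of_nonneg_left hinv hc
    _ = Real.log p / ((p : ℝ) - 1) - Real.log p / ((p : ℝ) - 1) * (1 - ((p : ℝ) ^ Nat.log p y)⁻¹) := by ring
    _ ≤ _ := by linarith

/-! ### Reindexing the multiples of `k` -/
/-- Reindexing the multiples of `k ≥ 1` in `{1, …, M}` by `n = j/k ∈ {1, …, ⌊M/k⌋}`. -/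
theorem sum_Icc_filter_dvd_eq {M k : ℕ} (hk : 1 ≤ k) (G : ℕ → ℝ) :
    ∑ j ∈ (Finset.Icc 1 M).filter (fun j => k ∣ j), G j = ∑ n ∈ Finset.Icc 1 (M / k), G (k * n) := by
  have hk0 : k ≠ 0 := by omega
  have hset : (Finset.Icc 1 M).filter (fun j => k ∣ j) =
      (Finset.Icc 1 (M / k)).map ⟨fun n => k * n, mul_right_injective₀ hk0⟩ := by
    ext j
    simp only [Finset.mem_filter, Finset.mem_Icc, Finset.mem_map, Function.Embedding.coeFn_mk]
    constructor
    · rintro ⟨⟨h1, h2⟩, ⟨n, rfl⟩⟩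
      refine ⟨n, ⟨?_, ?_⟩, rfl⟩
      · rcases Nat.eq_zero_or_pos n with h | h
        · subst h; simp at h1
        · exact h
      · exact (Nat.le_div_iff_mul_le hk).2 (by rw [mul_comm]; exact h2)
    · rintro ⟨n, ⟨h1, h2⟩, rfl⟩
      refine ⟨⟨?_, ?_⟩, dvd_mul_right k n⟩
      · have hn : n ≠ 0 := by omega
        exact Nat.one_le_iff_ne_zero.2 (Nat.mul_ne_zero hk0 hn)
      · have := (Nat.le_div_iff_mul_le hk).1 h2
        rw [mul_comm] at this
        exact this
  rw [hset, Finset.sum_map]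
  rfl

/-- **Harmonic mass of the multiples of `q`**: `Σ_{j ≤ M, q ∣ j} 1/j = (1/q)·H_{⌊M/q⌋}` (`q ≥ 1`) — under the truncated
harmonic measure `π_M(x) = 1/(xH_M)` the divisibility odds are `P(q ∣ X) = H_{⌊M/q⌋}/(q·H_M)` exactly
(CONTINUUM-LIMIT 23.18 (h): `= q^{−1}(1 − log q/L + O(L⁻²))`, the σ-model tilt `q^{−1−1/L}` to first order). -/
theorem sum_inv_multiples_eq {M q : ℕ} (hq : 1 ≤ q) :
    ∑ j ∈ (Finset.Icc 1 M).filter (fun j => q ∣ j), (1 : ℝ) / j =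
      (1 / (q : ℝ)) * ∑ n ∈ Finset.Icc 1 (M / q), (1 : ℝ) / n := by
  rw [sum_Icc_filter_dvd_eq hq (fun j => (1 : ℝ) / j), Finset.mul_sum]
  refine Finset.sum_congr rfl fun n _ => ?_
  have hq0 : (q : ℝ) ≠ 0 := by exact_mod_cast (show q ≠ 0 by omega)
  push_cast
  field_simp

/-- The π-mean of `φ₂`: `Σ_{k ≤ M} φ₂(k)/k = ½·Σ_{M/2 < k ≤ M} 1/k` (the even harmonic numbers cancel the lower half). -/
theorem sum_parityFun_two_div (M : ℕ) :
    ∑ k ∈ Finset.Icc 1 M, parityFun 2 k / (k : ℝ) = (1 / 2) * ∑ k ∈ Finset.Ioc (M / 2) M, (1 : ℝ) / k := by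
  have hsplit : ∀ k ∈ Finset.Icc 1 M, parityFun 2 k / (k : ℝ) =
      (1 / 2) * (1 / (k : ℝ)) - (if 2 ∣ k then 1 / (k : ℝ) else 0) := by
    intro k _
    by_cases h2 : 2 ∣ k
    · rw [parityFun_of_dvd h2, if_pos h2]; ring
    · rw [parityFun_of_not_dvd h2, if_neg h2]; ring
  rw [Finset.sum_congr rfl hsplit, Finset.sum_sub_distrib, ← Finset.mul_sum, ← Finset.sum_filter,
    sum_Icc_filter_dvd_eq (by norm_num : 1 ≤ 2) (fun j => 1 / (j : ℝ))]
  have heven : ∑ n ∈ Finset.Icc 1 (M / 2), (1 : ℝ) / ((2 * n : ℕ) : ℝ) =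
      (1 / 2) * ∑ n ∈ Finset.Icc 1 (M / 2), (1 : ℝ) / n := by
    rw [Finset.mul_sum]
    refine Finset.sum_congr rfl fun n _ => ?_
    push_cast
    ring
  rw [heven, ← mul_sub]
  congr 1
  have hI : ∀ n : ℕ, Finset.Icc 1 n = Finset.Ioc 0 n := fun n => by
    ext m; simp only [Finset.mem_Icc, Finset.mem_Ioc]; omega
  rw [hI, hI, ← Finset.sum_Ioc_consecutive (fun k : ℕ => (1 : ℝ) / k) (Nat.zero_le (M / 2)) (Nat.div_le_self M 2)]
  ring

/-- `0 ≤ Σ_{M/2 < k ≤ M} 1/k ≤ 1`. -/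
theorem sum_Ioc_half_inv_le_one (M : ℕ) : ∑ k ∈ Finset.Ioc (M / 2) M, (1 : ℝ) / k ≤ 1 := by
  rcases Nat.eq_zero_or_pos M with hM | hM
  · subst hM; simp
  have hle : ∀ k ∈ Finset.Ioc (M / 2) M, (1 : ℝ) / k ≤ 1 / ((M / 2 + 1 : ℕ) : ℝ) := by
    intro k hk
    have hk := (Finset.mem_Ioc.1 hk).1
    have h0 : (0 : ℝ) < ((M / 2 + 1 : ℕ) : ℝ) := by positivity
    exact one_div_le_one_div_of_le h0 (by exact_mod_cast hk)
  refine (Finset.sum_le_sum hle).trans ?_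
  rw [Finset.sum_const, Nat.card_Ioc, nsmul_eq_mul]
  have h1 : ((M - M / 2 : ℕ) : ℝ) ≤ ((M / 2 + 1 : ℕ) : ℝ) := by exact_mod_cast (by omega : M - M / 2 ≤ M / 2 + 1)
  have h0 : (0 : ℝ) < ((M / 2 + 1 : ℕ) : ℝ) := by positivity
  rw [mul_one_div, div_le_one h0]
  exact h1

/-! ### The test function -/
/-- The blocked-birth term `X(M) = Σ_{k ≤ M} (φ₂(k)/k)·𝟙[k odd]·r₂(⌊M/k⌋)` is at least `(log 2)/4`
(defect `r₂(y) ≥ (log 2)/y ≥ (log 2)k/M` and at least `M/2` odd states). -/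
theorem parityX_ge_quarter {M : ℕ} (hM : 1 ≤ M) :
    Real.log 2 / 4 ≤ ∑ k ∈ Icc 1 M, parityFun 2 k / (k : ℝ) * (if 2 ∣ k then 0 else
      (Real.log 2 / ((2 : ℝ) - 1) - ∑ n ∈ (Icc 1 (M / k)).filter (fun n => 2 ∣ n), (Λ n : ℝ) / n)) := by
  have hM0 : (0 : ℝ) < M := by exact_mod_cast hM
  -- each odd k contributes (1/(2k))·defect ≥ (1/(2k))·(log 2)·k/M = log 2/(2M); even k contribute 0
  have hterm : ∀ k ∈ Icc 1 M, (if Odd k then Real.log 2 / (2 * M) else 0) ≤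
      parityFun 2 k / (k : ℝ) * (if 2 ∣ k then 0 else
        (Real.log 2 / ((2 : ℝ) - 1) - ∑ n ∈ (Icc 1 (M / k)).filter (fun n => 2 ∣ n), (Λ n : ℝ) / n)) := by
    intro k hk
    have hk1 : 1 ≤ k := (Finset.mem_Icc.1 hk).1
    have hkM : k ≤ M := (Finset.mem_Icc.1 hk).2
    by_cases h2 : 2 ∣ k
    · have hno : ¬ Odd k := by rw [Nat.not_odd_iff_even]; exact even_iff_two_dvd.2 h2
      rw [if_neg hno, if_pos h2, mul_zero]
    · have ho : Odd k := Nat.odd_iff.2 (Nat.two_dvd_ne_zero.1 h2)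
      rw [if_pos ho, if_neg h2, parityFun_of_not_dvd h2]
      have hy : 1 ≤ M / k := (Nat.le_div_iff_mul_le hk1).2 (by simpa using hkM)
      have hdef := parityDefect_ge Nat.prime_two hy
      have hk0 : (0 : ℝ) < k := by exact_mod_cast hk1
      have hyk : ((M / k : ℕ) : ℝ) ≤ (M : ℝ) / k := Nat.cast_div_le
      have hy0 : (0 : ℝ) < ((M / k : ℕ) : ℝ) := by exact_mod_cast hy
      have h3 : Real.log 2 * k / M ≤ Real.log 2 / ((2 : ℝ) - 1) / ((M / k : ℕ) : ℝ) := by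
        rw [show ((2 : ℝ) - 1) = 1 by norm_num, div_one, div_le_div_iff₀ hM0 hy0]
        calc Real.log 2 * k * ((M / k : ℕ) : ℝ) ≤ Real.log 2 * k * ((M : ℝ) / k) :=
              mul_le_mul_of_nonneg_left hyk (by positivity)
          _ = Real.log 2 * M := by field_simp
      calc Real.log 2 / (2 * M) = (2 : ℝ)⁻¹ / k * (Real.log 2 * k / M) := by field_simp
        _ ≤ (2 : ℝ)⁻¹ / k * (Real.log 2 / ((2 : ℝ) - 1) -
              ∑ n ∈ (Icc 1 (M / k)).filter (fun n => 2 ∣ n), (Λ n : ℝ) / n) :=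
            mul_le_mul_of_nonneg_left (h3.trans hdef) (by positivity)
  refine le_trans ?_ (Finset.sum_le_sum hterm)
  rw [Finset.sum_ite, Finset.sum_const_zero, add_zero, Finset.sum_const, nsmul_eq_mul]
  -- at least (M+1)/2 ≥ M/2 odd numbers in {1,…,M}: the image of i ↦ 2i+1, i < (M+1)/2
  have hcard : (M : ℝ) / 2 ≤ (((Icc 1 M).filter (fun k => Odd k)).card : ℝ) := by
    have hle : (Finset.range ((M + 1) / 2)).card ≤ ((Icc 1 M).filter (fun k => Odd k)).card := by
      refine Finset.card_le_card_of_injOn (fun i => 2 * i + 1) (fun i hi => ?_) ?_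
      · have hi' := Finset.mem_range.1 hi
        simp only [Finset.mem_coe, Finset.mem_filter, Finset.mem_Icc]
        exact ⟨⟨by omega, by omega⟩, ⟨i, rfl⟩⟩
      · intro a _ b _ h
        simp only at h
        omega
    have h1 : (M : ℝ) / 2 ≤ (((M + 1) / 2 : ℕ) : ℝ) := by
      have : M ≤ 2 * ((M + 1) / 2) := by omega
      have h2 : (M : ℝ) ≤ 2 * (((M + 1) / 2 : ℕ) : ℝ) := by exact_mod_cast this
      linarith
    calc (M : ℝ) / 2 ≤ (((M + 1) / 2 : ℕ) : ℝ) := h1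
      _ = ((Finset.range ((M + 1) / 2)).card : ℝ) := by rw [Finset.card_range]
      _ ≤ _ := by exact_mod_cast hle
  calc Real.log 2 / 4 = (M : ℝ) / 2 * (Real.log 2 / (2 * M)) := by field_simp; ring
    _ ≤ (((Icc 1 M).filter (fun k => Odd k)).card : ℝ) * (Real.log 2 / (2 * M)) :=
        mul_le_mul_of_nonneg_right hcard (by positivity)

/-- **The centred 2-parity test function, with the blocked-birth term as a parameter.**  For `M ≥ 2` and any
`B ≤ X(M)` (`X` as in `parityX_ge_quarter`), `g = φ₂ − π(φ₂)/π(1)` is `π`-orthogonal to the constants, non-zero,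
has `‖g‖²_π ≤ H_M/4` (`H_M = Σ_{k ≤ M} 1/k`), and `E(g) ≤ (2 log 2/L)‖g‖²_π − (1/L)(B − log 2/(2H_M))`, `L = log M`:
precisely `E(g) = (2log 2/L)‖φ₂‖² − X/L` and `‖φ₂‖² − ‖g‖² = A²/(4H_M)`, `A = Σ_{odd ≤ M}1/k − Σ_{even ≤ M}1/k ∈ [0,1]`. -/
theorem parity_test_function_of_le {M : ℕ} (hM : 2 ≤ M) {B : ℝ}
    (hB : B ≤ ∑ k ∈ Icc 1 M, parityFun 2 k / (k : ℝ) * (if 2 ∣ k then 0 else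
      (Real.log 2 / ((2 : ℝ) - 1) - ∑ n ∈ (Icc 1 (M / k)).filter (fun n => 2 ∣ n), (Λ n : ℝ) / n))) :
    ∃ g : St M → ℝ, (∑ k : St M, g k / (k : ℕ) = 0) ∧ (∃ k : St M, g k ≠ 0) ∧
      (∑ k : St M, g k ^ 2 / (k : ℕ) ≤ (∑ k : St M, (1 : ℝ) / (k : ℕ)) / 4) ∧
      -(∑ k : St M, g k / (k : ℕ) * ∑ j : St M, walkGen M k j * g j) ≤
        (2 * Real.log 2 / Real.log M) * ∑ k : St M, g k ^ 2 / (k : ℕ) -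
          (1 / Real.log M) * (B - Real.log 2 / (2 * ∑ k : St M, (1 : ℝ) / (k : ℕ))) := by
  -- notation
  have hM1 : 1 ≤ M := by omega
  have hL : 0 < Real.log M := Real.log_pos (by exact_mod_cast (show 1 < M by omega))
  have hlog2 : 0 < Real.log 2 := Real.log_pos one_lt_two
  set φ : St M → ℝ := fun k => parityFun 2 k with hφ
  set H : ℝ := ∑ k : St M, (1 : ℝ) / (k : ℕ) with hHdef
  set Sφ : ℝ := ∑ k : St M, φ k / (k : ℕ) with hSφ
  set V : ℝ := ∑ k : St M, φ k ^ 2 / (k : ℕ) with hV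
  have h1mem : (1 : ℕ) ∈ Finset.Icc 1 M := Finset.mem_Icc.2 ⟨le_rfl, hM1⟩
  have hH0 : 0 < H := by
    rw [hHdef]
    exact lt_of_lt_of_le (by norm_num) (Finset.single_le_sum (f := fun k : St M => (1 : ℝ) / (k : ℕ))
      (fun k _ => by positivity) (Finset.mem_univ ⟨1, h1mem⟩))
  set m : ℝ := Sφ / H with hm
  -- V = H/4 (φ₂² ≡ 1/4)
  have hVH : V = H / 4 := by
    rw [hV, hHdef, Finset.sum_div]
    refine Finset.sum_congr rfl fun k _ => ?_
    have hsq : φ k ^ 2 = 1 / 4 := by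
      rw [hφ]; dsimp only
      by_cases h2 : 2 ∣ ((k : ℕ))
      · rw [parityFun_of_dvd h2]; norm_num
      · rw [parityFun_of_not_dvd h2]; norm_num
    rw [hsq]; ring
  -- ‖φ − m‖² = V − Sφ²/H
  have hnorm : ∑ k : St M, (φ k - m) ^ 2 / ((k : ℕ) : ℝ) = V - Sφ ^ 2 / H := by
    have e : ∀ k : St M, (φ k - m) ^ 2 / ((k : ℕ) : ℝ) =
        φ k ^ 2 / (k : ℕ) - 2 * m * (φ k / (k : ℕ)) + m ^ 2 * (1 / (k : ℕ)) := fun k => by ring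
    simp only [e, Finset.sum_add_distrib, Finset.sum_sub_distrib, ← Finset.mul_sum]
    rw [← hV, ← hSφ, ← hHdef, hm]
    field_simp
    ring
  refine ⟨fun k => φ k - m, ?_, ?_, ?_, ?_⟩
  · -- π-orthogonality
    simp only [sub_div, Finset.sum_sub_distrib]
    rw [show ∑ k : St M, m / ((k : ℕ) : ℝ) = m * H by
      rw [hHdef, Finset.mul_sum]; exact Finset.sum_congr rfl fun k _ => by ring]
    rw [hm, div_mul_cancel₀ _ hH0.ne', sub_self]
  · -- non-zero: φ(1) − φ(2) = 1, so φ(1) − m and φ(2) − m cannot both vanish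
    have h2 : (2 : ℕ) ∈ Finset.Icc 1 M := Finset.mem_Icc.2 ⟨by norm_num, by omega⟩
    have hφ1 : φ ⟨1, h1mem⟩ = (2 : ℝ)⁻¹ := parityFun_of_not_dvd (by norm_num)
    have hφ2 : φ ⟨2, h2⟩ = -(1 - (2 : ℝ)⁻¹) := parityFun_of_dvd (dvd_refl 2)
    by_cases hm1 : φ ⟨1, h1mem⟩ - m = 0
    · refine ⟨⟨2, h2⟩, ?_⟩
      show φ ⟨2, h2⟩ - m ≠ 0
      rw [hφ2]; rw [hφ1] at hm1
      intro h; linarith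
    · exact ⟨⟨1, h1mem⟩, hm1⟩
  · -- ‖g‖² ≤ H/4
    show ∑ k : St M, (φ k - m) ^ 2 / ((k : ℕ) : ℝ) ≤ H / 4
    rw [hnorm, ← hVH]
    linarith [div_nonneg (sq_nonneg Sφ) hH0.le]
  · -- the energy: shift invariance, then the parity eigen-relation
    show -(∑ k : St M, (φ k - m) / ((k : ℕ) : ℝ) * ∑ j : St M, walkGen M k j * (φ j - m)) ≤
        (2 * Real.log 2 / Real.log M) * ∑ k : St M, (φ k - m) ^ 2 / ((k : ℕ) : ℝ) -
          (1 / Real.log M) * (B - Real.log 2 / (2 * H))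
    have hshift := dirichlet_add_const M φ (-m)
    simp only [← sub_eq_add_neg] at hshift
    rw [hshift]
    -- Σ_j walkGen k j φ j via walkGen_parity (p = 2)
    have hrow : ∀ k : St M, ∑ j : St M, walkGen M k j * φ j =
        -((2 : ℝ) * Real.log 2 / ((2 : ℝ) - 1) / Real.log M) * φ k +
          (1 / Real.log M) * (if 2 ∣ (k : ℕ) then 0 else
            (Real.log 2 / ((2 : ℝ) - 1) - ∑ n ∈ (Icc 1 (M / k)).filter (fun n => 2 ∣ n), Λ n / n)) := by
      intro k
      have h := walkGen_parity (M := M) Nat.prime_two k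
      simpa using h
    -- E(φ) = (2log2/L) V − X/L
    set X : ℝ := ∑ k : St M, φ k / (k : ℕ) * (if 2 ∣ (k : ℕ) then 0 else
        (Real.log 2 / ((2 : ℝ) - 1) - ∑ n ∈ (Icc 1 (M / k)).filter (fun n => 2 ∣ n), Λ n / n)) with hX
    have hE : -(∑ k : St M, φ k / (k : ℕ) * ∑ j : St M, walkGen M k j * φ j) =
        (2 * Real.log 2 / Real.log M) * V - (1 / Real.log M) * X := by
      simp only [hrow, hV, hX, Finset.mul_sum, ← Finset.sum_sub_distrib, ← Finset.sum_neg_distrib]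
      refine Finset.sum_congr rfl fun k _ => ?_
      ring
    rw [hE, hnorm]
    -- X ≥ B (the sum over the subtype is the sum over `Icc 1 M`)
    have hXge : B ≤ X := by
      have e := Finset.sum_coe_sort (Finset.Icc 1 M) (fun k : ℕ => parityFun 2 k / (k : ℝ) *
        (if 2 ∣ k then 0 else
          (Real.log 2 / ((2 : ℝ) - 1) - ∑ n ∈ (Icc 1 (M / k)).filter (fun n => 2 ∣ n), (Λ n : ℝ) / n)))
      rw [hX]
      exact hB.trans_eq e.symm
    -- Sφ = ½ Σ_{M/2 < k ≤ M} 1/k ∈ [0, 1/2]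
    have hSφ' : Sφ = (1 / 2) * ∑ k ∈ Finset.Ioc (M / 2) M, (1 : ℝ) / k := by
      rw [hSφ, Finset.sum_coe_sort (Finset.Icc 1 M) (fun k => parityFun 2 k / (k : ℝ))]
      exact sum_parityFun_two_div M
    have hS0 : 0 ≤ Sφ := by
      rw [hSφ']; exact mul_nonneg (by norm_num) (Finset.sum_nonneg fun k _ => by positivity)
    have hS1 : Sφ ≤ 1 / 2 := by
      rw [hSφ']; linarith [sum_Ioc_half_inv_le_one M]
    have hS2 : Sφ ^ 2 ≤ 1 / 4 := by nlinarith
    -- 2 log 2 · Sφ²/H ≤ log 2/(2H)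
    have hkey : 2 * Real.log 2 * (Sφ ^ 2 / H) ≤ Real.log 2 / (2 * H) := by
      rw [show Real.log 2 / (2 * H) = 2 * Real.log 2 * ((1 / 4) / H) by field_simp; ring]
      exact mul_le_mul_of_nonneg_left (div_le_div_of_nonneg_right hS2 hH0.le) (by positivity)
    have hLinv : 0 < 1 / Real.log M := by positivity
    have e1 : 2 * Real.log 2 / Real.log M * V - 1 / Real.log M * X -
        (2 * Real.log 2 / Real.log M * (V - Sφ ^ 2 / H) - 1 / Real.log M * (B - Real.log 2 / (2 * H))) =
        (1 / Real.log M) * ((2 * Real.log 2 * (Sφ ^ 2 / H) - Real.log 2 / (2 * H)) + (B - X)) := by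
      ring
    have e2 : (1 / Real.log M) * ((2 * Real.log 2 * (Sφ ^ 2 / H) - Real.log 2 / (2 * H)) + (B - X)) ≤ 0 :=
      mul_nonpos_of_nonneg_of_nonpos hLinv.le (by linarith)
    linarith

/-- **The centred 2-parity test function** (`B = log 2/4` in `parity_test_function_of_le`): for `M ≥ 2` some
`g ⊥_π 1`, `g ≠ 0`, with `‖g‖²_π ≤ H_M/4` has `E(g) ≤ (2 log 2/L)‖g‖²_π − (1/L)(log 2/4 − log 2/(2H_M))`. -/
theorem parity_test_function {M : ℕ} (hM : 2 ≤ M) :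
    ∃ g : St M → ℝ, (∑ k : St M, g k / (k : ℕ) = 0) ∧ (∃ k : St M, g k ≠ 0) ∧
      (∑ k : St M, g k ^ 2 / (k : ℕ) ≤ (∑ k : St M, (1 : ℝ) / (k : ℕ)) / 4) ∧
      -(∑ k : St M, g k / (k : ℕ) * ∑ j : St M, walkGen M k j * g j) ≤
        (2 * Real.log 2 / Real.log M) * ∑ k : St M, g k ^ 2 / (k : ℕ) -
          (1 / Real.log M) * (Real.log 2 / 4 - Real.log 2 / (2 * ∑ k : St M, (1 : ℝ) / (k : ℕ))) :=
  parity_test_function_of_le hM (parityX_ge_quarter (by omega))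

end Summit.RiemannHypothesis.RiemannHypothesis.Theorems.IntegerScrew

end
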